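import Summits.QuantumFields.BalabanUV.T4Continuum.Support.NE3BlockPoincareLandau
import Summits.QuantumFields.BalabanUV.T4Continuum.Support.NE3BlockPoincareTangent
import Summits.QuantumFields.BalabanUV.T4Continuum.Support.NE3FlatWeightedCoercive
import HarnessLib

/-!
# T⁴ programme, node NE3 — row E-MLw-(w4)-P, flat file F3 (END): the N-FREE S-bound in the `Qcoarse` currency, the N-FREE
# block-Poincaré inequality for MATRIX directions, and **(P_1) ∕ (ML_w) AT THE FLAT BACKGROUND ON `flatTangentLandau` WITH THE
# N-FREE CONSTANTS `C_P = 9·card n`, `c_w = 1∕(10·card n)`**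

NE3 (node U1b), row NE3 OWNER `b2b-balaban-t4-ne3-p1` (gen 21), design ruling D-ne3p1-g21-1 (journal l.15420) §1 (VI)–(VII), END;
on F2 `NE3BlockPoincareLandau` (complex core), leaf-04-g4's `NE3BlockPoincareTangent` (entry bookkeeping) and leaf-02-g4's
`NE3FlatWeightedCoercive` (the (P_1) ∕ (ML_w) assemblies from a `dirSq` bound).

CONTENT ([folklore]; 0 sorry; 0 def):
§1 **`sum_norm_sq_iterate_Qcoarse_le_of_flatDiv`** — complex S-bound in leaf-04's currency:
   `Σ_z Σ_κ ‖(Qcoarse L)^[k] Y z κ‖² ≤ ((L^k)^d)⁻¹·(L^k)⁴·Σ_x Σ_κ ‖Y x κ − Y(x−e_κ) κ‖²` on `ker Tcoarse^[k] ∩ {flatDiv = 0}`;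
§2 matrices, entrywise: **`sum_nhsNormSq_le_of_tangentIter_flat_landau`** (`Σ nhsNormSq Y ≤ 9·(L^{j+1})²·Σ nhsNormSq ∂Y` for
   periodic `Y` with `TangentIter L j flat Y` and `flatDiv Y ≡ 0`; NO factor `n`, NO factor `N`) and its `dirSq` form
   **`dirSq_le_of_tangentIter_flat_landau`** (one factor `card n`);
§3 **`weightedPoincare_flatTangentLandau_nfree`**: `∀ Y ∈ flatTangentLandau L N k, (L^k)⁻²·dirSq Y F ≤ (9·card n)·curlSq 1 Y F`,
   `F = [0, N·L^k)^d`, `k ≥ 1` — (P_1) with an N-FREE constant (leaf-02-g4's `weightedPoincare_flatTangentLandau`: `card n·(5 + 2dN²)`);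
   **`weightedTangentCoercive_flatTangentLandau_nfree`**: `WeightedTangentCoercive L k 1 (flatTangentLandau L N k) (1∕(10·card n)) F`
   — (ML_w) at the flat background with an N-FREE constant (leaf-02-g4's `…_flatTangentLandau`: `1∕(card n·(6 + 2dN²))`).
This answers owner g20's question l.13446 (ii) («N-free weighted coercivity on `flatTangentLandau` — OPEN») in the affirmative.

HONEST FRAMING.  A theorem about OUR typed shapes at ONE (flat) configuration; (P_W) ∕ (ML_w) at the curved background
`W = cavg L U_B`, T-E_w and NE3 are NOT proved; nothing about Bałaban's minimisers; spine PROVED 0∕9; finite T⁴ rung (B)+1 — NOT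
infinite volume, NOT mass gap, NOT BetaPertH, NOT Clay.  ABSOLUTE RULE kept (nothing printed is a hypothesis; context:
[Balaban1985PropagatorsII] Thm 3.3 (3.46), [Balaban1984PropagatorsII] (2.153)).  PLACEMENT: `Summits/QuantumFields/BalabanUV/`;
imports accepted modules only.
-/

set_option autoImplicit false

open scoped BigOperators Matrix.Norms.L2Operator
open Finset

namespace Summit.QuantumFields.BalabanUV.T4Continuum.NE3BlockPoincareLandauEnd

open Literature.MathematicalPhysics.QuantumFieldTheory.Balaban1983to89
open B7Prop1Explicit
open T4AveragingDeficitWall (dirSq curlSq)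
open T4AveragingDeficitWallBoundary (periodBox mem_periodBox card_periodBox)
open AveragingDeficitPeriodicCounting (IsPeriodicDir)
open AveragingDeficitMultiLevelPrep (TangentIter)
open BlockAveragePushDirSplit (flat)
open MinimalActionWitness (flatCfg)
open SmoothRefineNeutral (Tcoarse)
open NE3TangentNoGoWords (dPot)
open NE3CoercivityScaling (flatTangentLandau flatDiv)
open NE3EnergyWeightedShapes (WeightedTangentCoercive)
open NE3TangentFlatStructure (Qcoarse framePot iterate_Tcoarse_eq_zero_iff framePot_add_period
  iterate_Tcoarse_eq_zero_of_tangentIter iterate_Tcoarse_entry_eq_zero)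
open NE3BlockLineAverage (iterate_Qcoarse_apply)
open MatrixNorms (nhsNormSq)
open NE3BlockPoincareTangent (sum_entries_eq_card_mul_nhs sum_entries_grad_eq_card_mul_nhs dirSq_le_card_mul_sum_nhs
  sum_nhs_grad_le)
open NE3BlockPoincareLandau (lineSum_sq_le_of_exact_of_flatDiv lineSum_eq_of_iterate_Tcoarse_eq_zero
  sum_norm_sq_le_of_iterate_Tcoarse_eq_zero_of_flatDiv)
open NE3FlatWeightedCoercive (weightedPoincare_flatCfg_of_dirSq_le weightedTangentCoercive_flatTangentLandau_of_poincare)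

noncomputable section

variable {d : ℕ}

/-! ## §1 The N-free S-bound in the `Qcoarse` currency (complex values) -/

/-- **THE N-FREE S-BOUND** in leaf-04's currency: `L, N ≥ 1`, `Y` `(L^k·N)`-periodic with `(Tcoarse L)^[k] Y = 0` and
`Σ_κ (Y x κ − Y (x − e_κ) κ) = 0` at every site ⇒
`Σ_{z∈periodBox N} Σ_κ ‖(Qcoarse L)^[k] Y z κ‖² ≤ ((L^k)^d)⁻¹·(L^k)⁴·Σ_x Σ_κ ‖Y x κ − Y (x − e_κ) κ‖²` (= `(L^k)^{4−d}·G_diag`; constant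
ONE). [folklore] -/
theorem sum_norm_sq_iterate_Qcoarse_le_of_flatDiv {L : ℕ} (hL : 1 ≤ L) {N : ℕ} (hN : 1 ≤ N) (k : ℕ)
    (Y : Site d → Fin d → ℂ) (hY : ∀ (x : Site d) (τ μ : Fin d), Y (x + ((L ^ k * N : ℕ) : ℤ) • e τ) μ = Y x μ)
    (hT : (Tcoarse L)^[k] Y = 0) (hdiv : ∀ x : Site d, ∑ κ : Fin d, (Y x κ - Y (x - e κ) κ) = 0) :
    ∑ z ∈ periodBox (d := d) N, ∑ κ : Fin d, ‖(Qcoarse L)^[k] Y z κ‖ ^ 2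
      ≤ ((((L ^ k : ℕ) : ℝ)) ^ d)⁻¹ * (((L ^ k : ℕ) : ℝ)) ^ 4
          * ∑ x ∈ periodBox (d := d) (L ^ k * N), ∑ κ : Fin d, ‖Y x κ - Y (x - e κ) κ‖ ^ 2 := by
  have hex := lineSum_eq_of_iterate_Tcoarse_eq_zero hL k Y hT
  have htil : ∀ (z : Site d) (κ : Fin d), (Qcoarse L)^[k] Y z κ = (((((L ^ k : ℕ) : ℝ)) ^ d)⁻¹ : ℝ) •
      ∑ v ∈ periodBox (d := d) (L ^ k), ∑ i ∈ range (L ^ k), Y (((L ^ k : ℕ) : ℤ) • z + v + (i : ℤ) • e κ) κ :=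
    fun z κ => iterate_Qcoarse_apply hL k Y z κ
  set M : ℕ := L ^ k with hMdef
  have hM : 1 ≤ M := Nat.one_le_pow _ _ hL
  have hMd : (0 : ℝ) < (M : ℝ) ^ d := by positivity
  have hY' : ∀ (y : Site d) (τ μ : Fin d), Y (y + ((L : ℤ) ^ k * N) • e τ) μ = Y y μ := by
    intro y τ μ; have := hY y τ μ; push_cast at this; exact this
  have hμ : ∀ (z : Site d) (τ : Fin d), framePot L k Y (z + (N : ℤ) • e τ) = framePot L k Y z :=
    framePot_add_period L k Y hY'
  have hS := lineSum_sq_le_of_exact_of_flatDiv hM hN (framePot L k Y) Y hμ hY hex hdiv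
  calc ∑ z ∈ periodBox (d := d) N, ∑ κ : Fin d, ‖(Qcoarse L)^[k] Y z κ‖ ^ 2
      = (((M : ℝ) ^ d)⁻¹) ^ 2 * ∑ z ∈ periodBox (d := d) N, ∑ κ : Fin d,
          ‖∑ v ∈ periodBox (d := d) M, ∑ i ∈ range M, Y ((M : ℤ) • z + v + (i : ℤ) • e κ) κ‖ ^ 2 := by
        rw [Finset.mul_sum]
        refine Finset.sum_congr rfl fun z _ => ?_
        rw [Finset.mul_sum]
        refine Finset.sum_congr rfl fun κ _ => ?_
        rw [htil, norm_smul, Real.norm_of_nonneg (by positivity), mul_pow]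
    _ ≤ (((M : ℝ) ^ d)⁻¹) ^ 2 * ((M : ℝ) ^ (d + 4) * ∑ x ∈ periodBox (d := d) (M * N), ∑ κ : Fin d, ‖Y x κ - Y (x - e κ) κ‖ ^ 2) :=
        mul_le_mul_of_nonneg_left hS (by positivity)
    _ = ((M : ℝ) ^ d)⁻¹ * (M : ℝ) ^ 4 * ∑ x ∈ periodBox (d := d) (M * N), ∑ κ : Fin d, ‖Y x κ - Y (x - e κ) κ‖ ^ 2 := by
        field_simp; ring

/-! ## §2 Matrix directions, entrywise -/

section Matrices

variable {n : Type*} [Fintype n] [DecidableEq n] [Nonempty n]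

omit [Fintype n] [DecidableEq n] [Nonempty n] in
/-- The flat divergence read in an entry. [folklore] -/
theorem flatDiv_entry_eq_zero {Y : Site d → Fin d → Matrix n n ℂ} (hdiv : ∀ x : Site d, flatDiv Y x = 0) (p q : n)
    (x : Site d) : ∑ κ : Fin d, (Y x κ p q - Y (x - e κ) κ p q) = 0 := by
  have h := congrArg (fun A : Matrix n n ℂ => A p q) (hdiv x)
  simpa only [flatDiv, Matrix.sum_apply, Matrix.sub_apply, Matrix.zero_apply] using h

/-- **N-FREE BLOCK-POINCARÉ ON THE k-FOLD FLAT TANGENT SPACE ∩ LANDAU, HILBERT–SCHMIDT CURRENCY**: `L, N ≥ 1`, `Y` an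
`(N·L^{j+1})`-periodic matrix direction with `TangentIter L j flat Y` and `flatDiv Y ≡ 0` ⇒
`Σ_{x∈periodBox(N·L^{j+1})} Σ_κ nhsNormSq (Y x κ) ≤ 9·(L^{j+1})²·Σ_x Σ_κ Σ_μ nhsNormSq (Y(x+e_μ) κ − Y x κ)` — k-free, L-free, N-FREE,
no factor `n` (leaf-04's `sum_nhsNormSq_le_of_tangentIter_flat`: `5 + 2d·N²` without the Landau condition). [folklore] -/
theorem sum_nhsNormSq_le_of_tangentIter_flat_landau {L : ℕ} (hL : 1 ≤ L) {N : ℕ} (hN : 1 ≤ N) {j : ℕ}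
    {Y : Site d → Fin d → Matrix n n ℂ} (hYper : IsPeriodicDir Y ((N * L ^ (j + 1) : ℕ) : ℤ))
    (hY : TangentIter L j (flat (d := d) (n := n)) Y) (hdiv : ∀ x : Site d, flatDiv Y x = 0) :
    ∑ x ∈ periodBox (d := d) (N * L ^ (j + 1)), ∑ κ : Fin d, nhsNormSq (Y x κ)
      ≤ 9 * ((L : ℝ) ^ (j + 1)) ^ 2
          * ∑ x ∈ periodBox (d := d) (N * L ^ (j + 1)), ∑ κ : Fin d, ∑ μ : Fin d, nhsNormSq (Y (x + e μ) κ - Y x κ) := by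
  have hT : (Tcoarse L)^[j + 1] Y = 0 := iterate_Tcoarse_eq_zero_of_tangentIter hL j Y hY
  rw [show N * L ^ (j + 1) = L ^ (j + 1) * N from Nat.mul_comm _ _]
  set F := periodBox (d := d) (L ^ (j + 1) * N) with hF
  have hent : ∀ pq : n × n, ∑ x ∈ F, ∑ κ : Fin d, ‖Y x κ pq.1 pq.2‖ ^ 2
      ≤ 9 * ((L : ℝ) ^ (j + 1)) ^ 2 * ∑ x ∈ F, ∑ κ : Fin d, ∑ μ : Fin d, ‖Y (x + e μ) κ pq.1 pq.2 - Y x κ pq.1 pq.2‖ ^ 2 := by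
    intro pq
    have hper : ∀ (x : Site d) (τ μ : Fin d),
        (fun y ν => Y y ν pq.1 pq.2) (x + ((L ^ (j + 1) * N : ℕ) : ℤ) • e τ) μ = (fun y ν => Y y ν pq.1 pq.2) x μ := by
      intro x τ μ
      simp only
      rw [show (L ^ (j + 1) * N : ℕ) = N * L ^ (j + 1) from Nat.mul_comm _ _, hYper x τ μ]
    exact sum_norm_sq_le_of_iterate_Tcoarse_eq_zero_of_flatDiv hL hN (j + 1) (fun y ν => Y y ν pq.1 pq.2) hper
      (iterate_Tcoarse_entry_eq_zero L hT pq.1 pq.2) (flatDiv_entry_eq_zero hdiv pq.1 pq.2)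
  have hsum := Finset.sum_le_sum fun pq (_ : pq ∈ (Finset.univ : Finset (n × n))) => hent pq
  rw [← Finset.mul_sum, sum_entries_eq_card_mul_nhs, sum_entries_grad_eq_card_mul_nhs] at hsum
  have hn : (0 : ℝ) < Fintype.card n := by exact_mod_cast Fintype.card_pos
  rw [mul_left_comm] at hsum
  exact le_of_mul_le_mul_left hsum hn

/-- **N-FREE BLOCK-POINCARÉ, OPERATOR-NORM CURRENCY**: under the same hypotheses,
`dirSq Y (periodBox (N·L^{j+1})) ≤ card n·9·(L^{j+1})²·Σ_x Σ_κ Σ_μ ‖Y(x+e_μ) κ − Y x κ‖²`. [folklore] -/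
theorem dirSq_le_of_tangentIter_flat_landau {L : ℕ} (hL : 1 ≤ L) {N : ℕ} (hN : 1 ≤ N) {j : ℕ}
    {Y : Site d → Fin d → Matrix n n ℂ} (hYper : IsPeriodicDir Y ((N * L ^ (j + 1) : ℕ) : ℤ))
    (hY : TangentIter L j (flat (d := d) (n := n)) Y) (hdiv : ∀ x : Site d, flatDiv Y x = 0) :
    dirSq Y (periodBox (d := d) (N * L ^ (j + 1)))
      ≤ Fintype.card n * 9 * ((L : ℝ) ^ (j + 1)) ^ 2
          * ∑ x ∈ periodBox (d := d) (N * L ^ (j + 1)), ∑ κ : Fin d, ∑ μ : Fin d, ‖Y (x + e μ) κ - Y x κ‖ ^ 2 := by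
  have h := sum_nhsNormSq_le_of_tangentIter_flat_landau hL hN hYper hY hdiv
  have hn : (0 : ℝ) ≤ Fintype.card n := Nat.cast_nonneg _
  calc dirSq Y (periodBox (d := d) (N * L ^ (j + 1)))
      ≤ Fintype.card n * ∑ x ∈ periodBox (d := d) (N * L ^ (j + 1)), ∑ κ : Fin d, nhsNormSq (Y x κ) :=
        dirSq_le_card_mul_sum_nhs Y _
    _ ≤ Fintype.card n * (9 * ((L : ℝ) ^ (j + 1)) ^ 2
          * ∑ x ∈ periodBox (d := d) (N * L ^ (j + 1)), ∑ κ : Fin d, ∑ μ : Fin d, nhsNormSq (Y (x + e μ) κ - Y x κ)) :=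
        mul_le_mul_of_nonneg_left h hn
    _ ≤ Fintype.card n * (9 * ((L : ℝ) ^ (j + 1)) ^ 2
          * ∑ x ∈ periodBox (d := d) (N * L ^ (j + 1)), ∑ κ : Fin d, ∑ μ : Fin d, ‖Y (x + e μ) κ - Y x κ‖ ^ 2) :=
        mul_le_mul_of_nonneg_left (mul_le_mul_of_nonneg_left (sum_nhs_grad_le Y _) (by positivity)) hn
    _ = _ := by ring

/-! ## §3 (P_1) and (ML_w) at the flat background on `flatTangentLandau L N k`, N-FREE constants -/

/-- The HS Poincaré hypothesis of leaf-02-g4's assemblies, with the N-FREE constant `9`, on `flatTangentLandau L N k` (`k ≥ 1`).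
[folklore] -/
theorem nhs_poincare_flatTangentLandau_nfree {L N : ℕ} (hL : 1 ≤ L) (hN : 1 ≤ N) {k : ℕ} (hk : 1 ≤ k) :
    ∀ Y ∈ flatTangentLandau (d := d) (n := n) L N k,
      ∑ x ∈ periodBox (N * L ^ k), ∑ κ : Fin d, nhsNormSq (Y x κ) ≤ 9 * (((L : ℝ) ^ k) ^ 2 *
        ∑ x ∈ periodBox (N * L ^ k), ∑ μ : Fin d, ∑ ν : Fin d, nhsNormSq (Y (x + e μ) ν - Y x ν)) := by
  intro Y hY
  obtain ⟨j, rfl⟩ : ∃ j, k = j + 1 := ⟨k - 1, by omega⟩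
  have htan : TangentIter L j (flat (d := d) (n := n)) Y := by
    have h1 : TangentIter L (j + 1 - 1) (flatCfg (d := d) (n := n)) Y := hY.2.2.1
    rw [Nat.add_sub_cancel] at h1
    exact h1
  have h := sum_nhsNormSq_le_of_tangentIter_flat_landau hL hN hY.2.1 htan hY.2.2.2
  have hS : ∑ x ∈ periodBox (d := d) (N * L ^ (j + 1)), ∑ κ : Fin d, ∑ μ : Fin d, nhsNormSq (Y (x + e μ) κ - Y x κ)
      = ∑ x ∈ periodBox (d := d) (N * L ^ (j + 1)), ∑ μ : Fin d, ∑ ν : Fin d, nhsNormSq (Y (x + e μ) ν - Y x ν) :=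
    Finset.sum_congr rfl fun _ _ => Finset.sum_comm
  rw [hS, mul_assoc] at h
  exact h

/-- **(P_1) ON `flatTangentLandau L N k` WITH AN N-FREE CONSTANT** (`L, N, k ≥ 1`):
`∀ Y ∈ flatTangentLandau L N k, (L^k)⁻²·dirSq Y F ≤ (9·card n)·curlSq 1 Y F`, `F = [0, N·L^k)^d` — the (P_U) currency of
`NE3WeightedCoercivityTransfer` at `U = 1`; compare leaf-02-g4's `weightedPoincare_flatTangentLandau` (`card n·(5 + 2d·N²)`). [folklore] -/
theorem weightedPoincare_flatTangentLandau_nfree {L N : ℕ} (hL : 1 ≤ L) (hN : 1 ≤ N) {k : ℕ} (hk : 1 ≤ k) :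
    ∀ Y ∈ flatTangentLandau (d := d) (n := n) L N k, (((L : ℝ) ^ k)⁻¹) ^ 2 * dirSq Y (periodBox (N * L ^ k))
      ≤ (9 * Fintype.card n) * curlSq (flatCfg (d := d) (n := n)) Y (periodBox (N * L ^ k)) := by
  have hNL : 1 ≤ N * L ^ k := Nat.mul_pos (by omega) (Nat.pow_pos (by omega))
  have hK : 0 ≤ (9 : ℝ) * Fintype.card n := by positivity
  refine weightedPoincare_flatCfg_of_dirSq_le hNL hK (fun _ hY => hY.2.1) (fun _ hY => hY.2.2.2) fun Y hY => ?_
  have h := nhs_poincare_flatTangentLandau_nfree hL hN hk Y hY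
  have hn : (0 : ℝ) ≤ Fintype.card n := Nat.cast_nonneg _
  calc dirSq Y (periodBox (N * L ^ k))
      ≤ Fintype.card n * ∑ x ∈ periodBox (N * L ^ k), ∑ κ : Fin d, nhsNormSq (Y x κ) := dirSq_le_card_mul_sum_nhs Y _
    _ ≤ Fintype.card n * (9 * (((L : ℝ) ^ k) ^ 2 *
        ∑ x ∈ periodBox (N * L ^ k), ∑ μ : Fin d, ∑ ν : Fin d, nhsNormSq (Y (x + e μ) ν - Y x ν))) :=
        mul_le_mul_of_nonneg_left h hn
    _ = _ := by ring

/-- **(ML_w) AT THE FLAT BACKGROUND ON `flatTangentLandau L N k` WITH AN N-FREE CONSTANT** (`L, N, k ≥ 1`):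
`WeightedTangentCoercive L k 1 (flatTangentLandau L N k) (1∕(card n·(1 + 9))) [0, N·L^k)^d` — compare leaf-02-g4's
`weightedTangentCoercive_flatTangentLandau` (`1∕(card n·(6 + 2d·N²))`).  The N-dependence of the fixed-torus currency was an
artefact of route (C1); the k-uniform constant on the constrained Landau tangent space is torus-size-free. [folklore] -/
theorem weightedTangentCoercive_flatTangentLandau_nfree {L N : ℕ} (hL : 1 ≤ L) (hN : 1 ≤ N) {k : ℕ} (hk : 1 ≤ k) :
    WeightedTangentCoercive L k (flatCfg (d := d) (n := n)) (flatTangentLandau L N k)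
      (1 / (Fintype.card n * (1 + 9))) (periodBox (N * L ^ k)) := by
  have hNL : 1 ≤ N * L ^ k := Nat.mul_pos (by omega) (Nat.pow_pos (by omega))
  exact weightedTangentCoercive_flatTangentLandau_of_poincare hNL (by norm_num) (nhs_poincare_flatTangentLandau_nfree hL hN hk)

end Matrices

end

end Summit.QuantumFields.BalabanUV.T4Continuum.NE3BlockPoincareLandauEnd
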